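import Literature.MathematicalPhysics.QuantumManyBody.GroundStateFeynmanKacCompact
import Literature.MathematicalPhysics.QuantumManyBody.GroundStateFeynmanKacSpectral
import Literature.Probability.Process.BrownianTube
import HarnessLib

/-!
# Ground-state Feynman–Kac: positivity improving and the Perron–Frobenius theorem for `e^{-tH_N}`

Topic `Literature/MathematicalPhysics/QuantumManyBody`; theorems only. Step of the proof of the
named fact `Literature.MathematicalPhysics.QuantumManyBody.BoseGas.GroundStateFeynmanKac`:

* `measure_tube_pos` — **tubes around straight lines have positive Wiener measure** for the `3N`
  Brownian coordinates (product of the one-dimensional support theorem of the tree,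
  `Literature.Probability.Process.measure_forall_abs_brownian_sub_le_pos`);
* `exists_margin_segment` — a uniform coordinate margin of the segment `[X, Y] ⊂ Λ_L^N`
  (convexity of the box);
* `fkReal_ge_of_tube` — **tube lower bound**: `(e^{-tH} h)(X) ≥ e^{-N²Ct} a P(tube)` when
  `h ≥ a` near the endpoint `Y` of the tube;
* `fkReal_one_pos` — positive survival: `(e^{-tH} 1)(X) > 0` on the open box;
* `fkReal_pos_of_nonneg` — **positivity improving** (Chung–Zhao (1995), Thm 2.4 with (3.34):
  `p^D(t; x, y) > 0` on `D × D`; Reed–Simon IV §XIII.12): for `g ≥ 0` not a.e. zero on the box,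
  `(e^{-tH} g)(X) > 0` at EVERY point `X` of the open box;
* `fkL2_perronFrobenius` — **Perron–Frobenius for `e^{-tH_N}` on `L²(Λ_L^N)`** (Reed–Simon IV
  Thm XIII.44; Glimm–Jaffe Thms 3.3.2–3.3.3): `e^{-tH}` has a unit eigenvector `e ≥ 0` for the
  eigenvalue `‖e^{-tH}‖ > 0`, a.e. strictly positive on the box, and every eigenvector for that
  eigenvalue is a multiple of `e`.

## References

* K. L. Chung, Z. Zhao, *From Brownian Motion to Schrödinger's Equation* (1995), Thm 2.4,
  (3.34), Thm 8.11. [ChungZhao1995]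
* M. Reed, B. Simon, *Methods of Modern Mathematical Physics IV* (1978), §XIII.12,
  Thm XIII.44. [ReedSimonIV1978]
* J. Glimm, A. Jaffe, *Quantum Physics* (1987), Thms 3.3.2–3.3.3. [GlimmJaffeQP1987]
-/

noncomputable section

namespace Literature.MathematicalPhysics.QuantumManyBody.BoseGas

open MeasureTheory ProbabilityTheory Filter Set Metric
open scoped ENNReal NNReal Topology InnerProductSpace
open Literature.Probability.Process

variable {N : ℕ}

/-! ### Tubes around straight lines -/

/-- **Tubes around straight lines have positive Wiener measure** (`3N` coordinates): for
`t > 0`, `ε > 0` and any `d : Fin N → Fin 3 → ℝ`,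
`P(∀ i k, ∀ s ≤ t, |b_s(i,k) - (s/t) d_{ik}| ≤ ε) > 0` (product of one-dimensional tube
probabilities around the Lipschitz centres `s ↦ (s/t) d_{ik}`). Freedman (1971) §1.6;
Stroock–Varadhan (1972) §3. [folklore] -/
theorem measure_tube_pos (t : ℝ≥0) (ht : t ≠ 0) (d : Fin N → Fin 3 → ℝ) {ε : ℝ} (hε : 0 < ε) :
    0 < wienerPaths N {ω | ∀ (i : Fin N) (k : Fin 3) (s : ℝ≥0), s ≤ t →
      |brownian s (ω i k) - (s / t) * d i k| ≤ ε} := by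
  haveI := Literature.Probability.RandomPlanarGeometry.isProbabilityMeasure_preWienerMeasure'
  set A : Fin N → Fin 3 → Set (ℝ≥0 → ℝ) := fun i k =>
    {η | ∀ s : ℝ≥0, s ≤ t → |brownian s η - (s / t) * d i k| ≤ ε} with hA
  have hset : {ω : PathSpace N | ∀ (i : Fin N) (k : Fin 3) (s : ℝ≥0), s ≤ t →
      |brownian s (ω i k) - (s / t) * d i k| ≤ ε} =
      Set.pi Set.univ fun i => Set.pi Set.univ fun k => A i k := by
    ext ω; simp [hA]
  have hpos : ∀ i k, 0 < preWienerMeasure (A i k) := by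
    intro i k
    have ht0 : (0 : ℝ) < t := lt_of_le_of_ne t.coe_nonneg (fun h => ht (by exact_mod_cast h.symm))
    refine measure_forall_abs_brownian_sub_le_pos t hε (L := |d i k| / t) (by positivity) (by simp)
      (fun s u hsu _ => ?_)
    rw [← sub_mul, abs_mul, ← sub_div, abs_div, abs_of_nonneg t.coe_nonneg,
      abs_of_nonneg (sub_nonneg.2 (by exact_mod_cast hsu))]
    rw [div_mul_eq_mul_div, mul_comm, ← div_mul_eq_mul_div]
  rw [hset, wienerPaths, Measure.pi_pi]
  refine pos_iff_ne_zero.2 (Finset.prod_ne_zero_iff.2 fun i _ => ?_)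
  rw [Measure.pi_pi]
  exact Finset.prod_ne_zero_iff.2 fun k _ => (hpos i k).ne'

/-- **A closed condition at all rational times of `[0, t]` holds at all times** (`t > 0`), for a
continuous function of time. [folklore] -/
theorem forall_le_of_forall_rat {φ : ℝ≥0 → ℝ} (hφ : Continuous φ) {t : ℝ≥0} (ht : t ≠ 0) {c : ℝ}
    (h : ∀ q : ℚ, (q : ℝ) ∈ Set.Icc (0 : ℝ) t → φ (q : ℝ).toNNReal ≤ c) {s : ℝ≥0} (hs : s ≤ t) :
    φ s ≤ c := by
  set g : ℝ → ℝ := fun r => φ r.toNNReal with hg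
  have hgc : Continuous g := hφ.comp continuous_real_toNNReal
  set S : Set ℝ := {r | g r ≤ c} with hS
  have hSc : IsClosed S := isClosed_le hgc continuous_const
  have hrat : Set.Ioo (0 : ℝ) t ∩ Set.range ((↑) : ℚ → ℝ) ⊆ S := by
    rintro _ ⟨hq, q, rfl⟩
    exact h q (Set.Ioo_subset_Icc_self hq)
  have hIoo : Set.Ioo (0 : ℝ) t ⊆ S :=
    (Rat.denseRange_cast.open_subset_closure_inter isOpen_Ioo).trans (closure_minimal hrat hSc)
  have ht0 : (0 : ℝ) ≠ t := fun h0 => ht (by exact_mod_cast h0.symm)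
  have hIcc : Set.Icc (0 : ℝ) t ⊆ S := by
    rw [← closure_Ioo ht0]
    exact closure_minimal hIoo hSc
  have hmem : (s : ℝ) ∈ S := hIcc ⟨s.coe_nonneg, by exact_mod_cast hs⟩
  simpa [hS, hg] using hmem

/-- The tube event read at rational times contains the tube event, hence has positive Wiener
measure; it is measurable (countably many conditions). [folklore] -/
theorem measure_ratTube_pos (t : ℝ≥0) (ht : t ≠ 0) (d : Fin N → Fin 3 → ℝ) {ε : ℝ} (hε : 0 < ε) :
    0 < wienerPaths N {ω | ∀ (i : Fin N) (k : Fin 3) (q : ℚ), (q : ℝ) ∈ Set.Icc (0 : ℝ) t →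
      |brownian (q : ℝ).toNNReal (ω i k) - ((q : ℝ) / t) * d i k| ≤ ε} := by
  refine (measure_tube_pos t ht d hε).trans_le (measure_mono fun ω hω i k q hq => ?_)
  have h := hω i k (q : ℝ).toNNReal (Real.toNNReal_le_iff_le_coe.2 hq.2)
  rwa [Real.coe_toNNReal _ hq.1] at h

/-- The rational tube event is measurable. [folklore] -/
theorem measurableSet_ratTube (t : ℝ≥0) (d : Fin N → Fin 3 → ℝ) (ε : ℝ) :
    MeasurableSet {ω : PathSpace N | ∀ (i : Fin N) (k : Fin 3) (q : ℚ), (q : ℝ) ∈ Set.Icc (0 : ℝ) t →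
      |brownian (q : ℝ).toNNReal (ω i k) - ((q : ℝ) / t) * d i k| ≤ ε} := by
  have hset : {ω : PathSpace N | ∀ (i : Fin N) (k : Fin 3) (q : ℚ), (q : ℝ) ∈ Set.Icc (0 : ℝ) t →
      |brownian (q : ℝ).toNNReal (ω i k) - ((q : ℝ) / t) * d i k| ≤ ε} =
      ⋂ i : Fin N, ⋂ k : Fin 3, ⋂ q : ℚ, {ω : PathSpace N | (q : ℝ) ∈ Set.Icc (0 : ℝ) t →
        |brownian (q : ℝ).toNNReal (ω i k) - ((q : ℝ) / t) * d i k| ≤ ε} := by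
    ext ω; simp
  rw [hset]
  refine MeasurableSet.iInter fun i => MeasurableSet.iInter fun k => MeasurableSet.iInter fun q => ?_
  by_cases hq : (q : ℝ) ∈ Set.Icc (0 : ℝ) t
  · simp only [hq, forall_const]
    refine measurableSet_le ?_ measurable_const
    exact (((measurable_brownian _).comp ((measurable_pi_apply k).comp (measurable_pi_apply i))).sub
      measurable_const).abs
  · simp [hq]

/-! ### Geometry of the box: a uniform coordinate margin along a segment -/

/-- **A uniform coordinate margin along the segment `[X, Y]` in the open box**: there is `ε > 0`
such that any configuration within coordinate distance `ε` of a convex combination of `X` and `Y`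
lies in the box. [folklore] -/
theorem exists_margin_segment {L : ℝ} {X Y : Config N} (hX : X ∈ boxN N L) (hY : Y ∈ boxN N L) :
    ∃ ε > 0, ∀ (W : Config N) (θ : ℝ), θ ∈ Set.Icc (0 : ℝ) 1 →
      (∀ i k, |W i k - ((1 - θ) * X i k + θ * Y i k)| ≤ ε) → W ∈ boxN N L := by
  classical
  -- the coordinate margins
  set m : Fin N × Fin 3 → ℝ := fun p =>
    min (min (X p.1 p.2) (Y p.1 p.2)) (min (L - X p.1 p.2) (L - Y p.1 p.2)) with hm
  have hmpos : ∀ p, 0 < m p := fun p => by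
    have h1 := (hX p.1) p.2
    have h2 := (hY p.1) p.2
    simp only [hm]
    refine lt_min (lt_min h1.1 h2.1) (lt_min (sub_pos.2 h1.2) (sub_pos.2 h2.2))
  -- a positive `ε` below all margins
  obtain ⟨ε, hε, hεm⟩ : ∃ ε > 0, ∀ p, ε < m p := by
    by_cases hne : (Finset.univ : Finset (Fin N × Fin 3)).Nonempty
    · refine ⟨Finset.univ.inf' hne m / 2, half_pos ((Finset.lt_inf'_iff hne).2 fun p _ => hmpos p),
        fun p => ?_⟩
      have h := Finset.inf'_le m (Finset.mem_univ p)
      linarith [hmpos p]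
    · refine ⟨1, one_pos, fun p => ?_⟩
      exact absurd ⟨p, Finset.mem_univ p⟩ hne
  refine ⟨ε, hε, fun W θ hθ hW i k => ⟨?_, ?_⟩⟩
  · have h := hW i k
    have hm1 : ε < min (X i k) (Y i k) := (hεm (i, k)).trans_le (min_le_left _ _)
    have hc : min (X i k) (Y i k) ≤ (1 - θ) * X i k + θ * Y i k := by
      nlinarith [min_le_left (X i k) (Y i k), min_le_right (X i k) (Y i k), hθ.1, hθ.2]
    rw [abs_le] at h
    linarith
  · have h := hW i k
    have hm2 : ε < min (L - X i k) (L - Y i k) := (hεm (i, k)).trans_le (min_le_right _ _)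
    have hc : (1 - θ) * X i k + θ * Y i k ≤ max (X i k) (Y i k) := by
      nlinarith [le_max_left (X i k) (Y i k), le_max_right (X i k) (Y i k), hθ.1, hθ.2]
    rw [abs_le] at h
    have : max (X i k) (Y i k) + ε < L := by
      rcases le_total (X i k) (Y i k) with hxy | hxy
      · rw [max_eq_right hxy]; linarith [min_le_right (L - X i k) (L - Y i k)]
      · rw [max_eq_left hxy]; linarith [min_le_left (L - X i k) (L - Y i k)]
    linarith

/-! ### The tube lower bound -/

/-- On the `ε/√2`-tube around `s ↦ (s/t)(Y - X)/√2` the world-lines from `X` stay within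
coordinate distance `ε` of the straight line from `X` to `Y`. [folklore] -/
theorem abs_worldLine_sub_line_le {X Y : Config N} {t : ℝ≥0} (ht : t ≠ 0) {ε : ℝ}
    {ω : PathSpace N}
    (hω : ∀ (i : Fin N) (k : Fin 3) (q : ℚ), (q : ℝ) ∈ Set.Icc (0 : ℝ) t →
      |brownian (q : ℝ).toNNReal (ω i k) - ((q : ℝ) / t) * ((Y i k - X i k) / Real.sqrt 2)| ≤
        ε / Real.sqrt 2)
    (i : Fin N) (k : Fin 3) {s : ℝ≥0} (hs : s ≤ t) :
    |worldLine X ω s i k - ((1 - s / t) * X i k + (s / t) * Y i k)| ≤ ε := by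
  have h2 : (0 : ℝ) < Real.sqrt 2 := Real.sqrt_pos.2 (by norm_num)
  -- from rational to all times by continuity
  have h : |brownian s (ω i k) - (s / t) * ((Y i k - X i k) / Real.sqrt 2)| ≤ ε / Real.sqrt 2 := by
    refine forall_le_of_forall_rat (φ := fun s : ℝ≥0 =>
      |brownian s (ω i k) - (s / t) * ((Y i k - X i k) / Real.sqrt 2)|) ?_ ht (fun q hq => ?_) hs
    · exact ((continuous_brownian (ω i k)).sub ((NNReal.continuous_coe.div_const _).mul
        continuous_const)).abs
    · have := hω i k q hq
      simpa only [Real.coe_toNNReal _ hq.1] using this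
  have hwl : worldLine X ω s i k = X i k + Real.sqrt 2 * brownian s (ω i k) := by
    simp [worldLine]
  rw [hwl]
  have key : X i k + Real.sqrt 2 * brownian s (ω i k) - ((1 - s / t) * X i k + (s / t) * Y i k) =
      Real.sqrt 2 * (brownian s (ω i k) - (s / t) * ((Y i k - X i k) / Real.sqrt 2)) := by
    field_simp
    ring
  rw [key, abs_mul, abs_of_pos h2]
  calc Real.sqrt 2 * |brownian s (ω i k) - (s / t) * ((Y i k - X i k) / Real.sqrt 2)|
      ≤ Real.sqrt 2 * (ε / Real.sqrt 2) := mul_le_mul_of_nonneg_left h h2.le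
    _ = ε := mul_div_cancel₀ ε h2.ne'

/-- **Tube lower bound for the Feynman–Kac functional.** Let `v ≤ C` be measurable, `t > 0`,
`X, Y` in the open box with the margin `ε` of `exists_margin_segment`, and `h ≥ 0` a bounded
measurable observable with `h ≥ a ≥ 0` on the coordinate `ε`-box around `Y`. Then
`(e^{-tH} h)(X) ≥ e^{-N²Ct} a P(tube)`: on the tube event the world-lines survive, pick up at
most `N²Ct` of action, and end in the `ε`-box around `Y`. [folklore] -/
theorem fkReal_ge_of_tube {v : ℝ → ℝ≥0∞} (hv : Measurable v) {C : ℝ≥0} (hC : ∀ r, v r ≤ C)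
    {L : ℝ} {t : ℝ≥0} (ht : t ≠ 0) {X Y : Config N} {ε : ℝ}
    (hmargin : ∀ (W : Config N) (θ : ℝ), θ ∈ Set.Icc (0 : ℝ) 1 →
      (∀ i k, |W i k - ((1 - θ) * X i k + θ * Y i k)| ≤ ε) → W ∈ boxN N L)
    {h : Config N → ℝ} (hh : Measurable h) (hh0 : ∀ Z, 0 ≤ h Z) {K : ℝ} (hK : ∀ Z, |h Z| ≤ K)
    {a : ℝ} (ha : 0 ≤ a) (hha : ∀ Z : Config N, (∀ i k, |Z i k - Y i k| ≤ ε) → a ≤ h Z) :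
    Real.exp (-((N * N : ℕ) * C * t)) * a *
        (wienerPaths N {ω | ∀ (i : Fin N) (k : Fin 3) (q : ℚ), (q : ℝ) ∈ Set.Icc (0 : ℝ) t →
          |brownian (q : ℝ).toNNReal (ω i k) - ((q : ℝ) / t) * ((Y i k - X i k) / Real.sqrt 2)| ≤
            ε / Real.sqrt 2}).toReal ≤
      fkReal v L t h X := by
  set E : Set (PathSpace N) := {ω | ∀ (i : Fin N) (k : Fin 3) (q : ℚ), (q : ℝ) ∈ Set.Icc (0 : ℝ) t →
    |brownian (q : ℝ).toNNReal (ω i k) - ((q : ℝ) / t) * ((Y i k - X i k) / Real.sqrt 2)| ≤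
      ε / Real.sqrt 2} with hE
  -- on the tube: survival, small action, endpoint near `Y`
  have hsurv : ∀ ω ∈ E, ω ∈ survives L t X := by
    intro ω hω s hs
    have hst : s.toNNReal ≤ t := Real.toNNReal_le_iff_le_coe.2 hs.2
    refine hmargin _ (s.toNNReal / t) ⟨by positivity, ?_⟩ fun i k =>
      abs_worldLine_sub_line_le ht hω i k hst
    rw [div_le_one (by exact_mod_cast pos_iff_ne_zero.2 ht)]
    exact_mod_cast hst
  have hend : ∀ ω ∈ E, a ≤ h (worldLine X ω t) := by
    intro ω hω
    refine hha _ fun i k => ?_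
    have h1 := abs_worldLine_sub_line_le (Y := Y) ht hω i k (le_refl t)
    rwa [div_self (by exact_mod_cast ht : (t : ℝ) ≠ 0), sub_self, zero_mul, zero_add, one_mul] at h1
  have hw : ∀ ω ∈ E, Real.exp (-((N * N : ℕ) * C * t)) ≤ (fkWeight v L t X ω).toReal := by
    intro ω hω
    have h1 := one_sub_toReal_fkWeight_le hC L t.coe_nonneg X ω
    rw [Set.indicator_of_notMem (Set.notMem_compl_iff.mpr (hsurv ω hω)), zero_add] at h1
    -- `w ≥ e^{-N²Ct}` directly from the action bound
    rw [fkWeight, Set.indicator_of_mem (hsurv ω hω)]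
    have hA : pathAction v t X ω ≤ (N * N : ℕ) * (C : ℝ≥0∞) * ENNReal.ofReal t :=
      pathAction_le_of_le (C := (C : ℝ≥0∞)) (fun r => hC r) t X ω
    have hM : ((N * N : ℕ) * (C : ℝ≥0∞) * ENNReal.ofReal t) ≠ ⊤ :=
      ENNReal.mul_ne_top (ENNReal.mul_ne_top (ENNReal.natCast_ne_top _) ENNReal.coe_ne_top)
        ENNReal.ofReal_ne_top
    have hmono : (expNeg ((N * N : ℕ) * (C : ℝ≥0∞) * ENNReal.ofReal t)).toReal ≤
        (expNeg (pathAction v t X ω)).toReal :=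
      ENNReal.toReal_mono ((expNeg_le_one _).trans_lt ENNReal.one_lt_top).ne (expNeg_antitone hA)
    refine le_trans (le_of_eq ?_) hmono
    rw [expNeg, if_neg hM, ENNReal.toReal_ofReal (Real.exp_pos _).le]
    congr 1
    rw [ENNReal.toReal_mul, ENNReal.toReal_mul, ENNReal.toReal_ofReal t.coe_nonneg]
    simp
  -- integrate the indicator of the tube event from below
  have hmeas : MeasurableSet E := measurableSet_ratTube t _ _
  have hint : Integrable (fun ω : PathSpace N =>
      (fkWeight v L t X ω).toReal * h (worldLine X ω t)) (wienerPaths N) := by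
    have hm : Measurable fun ω : PathSpace N =>
        (fkWeight v L t X ω).toReal * h (worldLine X ω t) :=
      (measurable_fkWeight hv L t X).ennreal_toReal.mul (hh.comp (measurable_worldLine X t))
    refine (integrable_const K).mono' hm.aestronglyMeasurable (Eventually.of_forall fun ω => ?_)
    rw [Real.norm_eq_abs, abs_mul, abs_of_nonneg ENNReal.toReal_nonneg]
    have hw1 : (fkWeight v L t X ω).toReal ≤ 1 := by
      simpa using ENNReal.toReal_mono ENNReal.one_ne_top (fkWeight_le_one v L t X ω)
    calc (fkWeight v L t X ω).toReal * |h (worldLine X ω t)| ≤ 1 * K :=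
          mul_le_mul hw1 (hK _) (abs_nonneg _) zero_le_one
      _ = K := one_mul K
  calc Real.exp (-((N * N : ℕ) * C * t)) * a * (wienerPaths N E).toReal
      = ∫ ω, E.indicator (fun _ => Real.exp (-((N * N : ℕ) * C * t)) * a) ω ∂wienerPaths N := by
        rw [integral_indicator_const _ hmeas, smul_eq_mul, mul_comm, measureReal_def]
    _ ≤ ∫ ω, (fkWeight v L t X ω).toReal * h (worldLine X ω t) ∂wienerPaths N := by
        refine integral_mono_of_nonneg (Eventually.of_forall fun ω => ?_) hint
          (Eventually.of_forall fun ω => ?_)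
        · exact Set.indicator_nonneg (fun _ _ => by positivity) _
        · by_cases hω : ω ∈ E
          · rw [Set.indicator_of_mem hω]
            exact mul_le_mul (hw ω hω) (hend ω hω) ha ENNReal.toReal_nonneg
          · rw [Set.indicator_of_notMem hω]
            exact mul_nonneg ENNReal.toReal_nonneg (hh0 _)
    _ = fkReal v L t h X := by rw [fkReal, Real.toNNReal_coe]

/-! ### Positive survival and positivity improving -/

/-- Coordinate closeness controls the distance: `dist Z Y ≤ √3 ε` if `|Z i k - Y i k| ≤ ε`.
[folklore] -/
theorem dist_le_of_abs_coord_le {Z Y : Config N} {ε : ℝ} (hε : 0 ≤ ε)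
    (h : ∀ i k, |Z i k - Y i k| ≤ ε) : dist Z Y ≤ Real.sqrt 3 * ε := by
  refine (dist_pi_le_iff (by positivity)).2 fun i => ?_
  rw [EuclideanSpace.dist_eq]
  have hk : ∀ k : Fin 3, dist (Z i k) (Y i k) ^ 2 ≤ ε ^ 2 := fun k => by
    rw [Real.dist_eq]
    exact pow_le_pow_left₀ (abs_nonneg _) (h i k) 2
  calc Real.sqrt (∑ k, dist (Z i k) (Y i k) ^ 2) ≤ Real.sqrt (∑ _k : Fin 3, ε ^ 2) :=
        Real.sqrt_le_sqrt (Finset.sum_le_sum fun k _ => hk k)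
    _ = Real.sqrt 3 * ε := by
        rw [Finset.sum_const, Finset.card_univ, Fintype.card_fin, nsmul_eq_mul, Nat.cast_ofNat,
          Real.sqrt_mul (by norm_num), Real.sqrt_sq hε]

/-- **Positive survival**: `(e^{-sH} 1)(X) > 0` at every point of the open box (`s > 0`): the
tube around the constant path at `X` has positive probability. Chung–Zhao (1995), Thm 2.4
(`p^D(t; x, ·) > 0`). [cite: ChungZhao1995, Thm 2.4] -/
theorem fkReal_one_pos {v : ℝ → ℝ≥0∞} (hv : Measurable v) {C : ℝ≥0} (hC : ∀ r, v r ≤ C) {L : ℝ}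
    {s : ℝ} (hs : 0 < s) {X : Config N} (hX : X ∈ boxN N L) :
    0 < fkReal v L s (fun _ => (1 : ℝ)) X := by
  obtain ⟨ε, hε, hmargin⟩ := exists_margin_segment hX hX
  have hs' : s.toNNReal ≠ 0 := by simpa using hs
  have hlow := fkReal_ge_of_tube hv hC hs' hmargin measurable_const (fun _ => zero_le_one)
    (K := 1) (fun _ => by simp) zero_le_one (fun _ _ => le_rfl)
  have hpos := measure_ratTube_pos (N := N) s.toNNReal hs'
    (fun i k => (X i k - X i k) / Real.sqrt 2) (ε := ε / Real.sqrt 2) (by positivity)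
  rw [Real.coe_toNNReal _ hs.le] at hlow hpos
  refine lt_of_lt_of_le ?_ hlow
  exact mul_pos (mul_pos (Real.exp_pos _) one_pos) (ENNReal.toReal_pos hpos.ne' (measure_ne_top _ _))

/-- **Positivity improving of `e^{-tH_N}`**: for a measurable `g ≥ 0` square integrable on the box
and NOT a.e. zero there, `(e^{-tH} g)(X) > 0` at EVERY point `X` of the open box (`t > 0`).
Write `e^{-tH} g = e^{-tH/2} h` with `h = e^{-tH/2} g ≥ 0` continuous on the box (strong Feller);
`∫_Λ h = ∫_Λ g · e^{-tH/2} 1 > 0` by symmetry and positive survival, so `h(Y) > 0` somewhere,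
and the tube from `X` to `Y` transports positivity. Chung–Zhao (1995), Thm 2.4 with (3.34);
Reed–Simon IV §XIII.12 (`e^{-tH}` is positivity improving). [cite: ChungZhao1995, Thm 2.4] -/
theorem fkReal_pos_of_nonneg {v : ℝ → ℝ≥0∞} (hv : Measurable v) {C : ℝ≥0} (hC : ∀ r, v r ≤ C)
    {L : ℝ} {t : ℝ} (ht : 0 < t) {g : Config N → ℝ} (hg : Measurable g) (hg0 : ∀ Y, 0 ≤ g Y)
    (hg2 : ∫⁻ Y in boxN N L, ‖g Y‖ₑ ^ (2 : ℝ) ≠ ⊤)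
    (hne : ¬ g =ᵐ[volume.restrict (boxN N L)] 0) {X : Config N} (hX : X ∈ boxN N L) :
    0 < fkReal v L t g X := by
  have ht2 : 0 < t / 2 := half_pos ht
  -- `h = e^{-tH/2} g`
  set h : Config N → ℝ := fkReal v L (t / 2) g with hh
  have hhm : Measurable h := measurable_fkReal hv L _ hg
  have hh0 : ∀ Z, 0 ≤ h Z := fun Z => fkReal_nonneg v L _ hg0 Z
  set M : ℝ := ((∫⁻ Y in boxN N L, ‖g Y‖ₑ ^ (2 : ℝ)) ^ (1 / 2 : ℝ)).toReal with hM
  have hM0 : 0 ≤ M := ENNReal.toReal_nonneg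
  have hgM : (∫⁻ Y in boxN N L, ‖g Y‖ₑ ^ (2 : ℝ)) ^ (1 / 2 : ℝ) ≤ ENNReal.ofReal M := by
    rw [hM, ENNReal.ofReal_toReal (ENNReal.rpow_ne_top_of_nonneg (by norm_num) hg2)]
  have hhK : ∀ Z, |h Z| ≤ ((∏ _i : Fin N, ∏ _k : Fin 3,
      ENNReal.ofReal (Real.sqrt (2 * Real.pi * (2 * (t / 2).toNNReal)))⁻¹) ^ (1 / 2 : ℝ)).toReal * M :=
    fun Z => abs_fkReal_le_heatConst v L ht2 le_rfl hg hM0 hgM Z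
  -- `∫_Λ h = ∫_Λ g · e^{-tH/2} 1 > 0`
  have h1mass : ∫⁻ Y in boxN N L, ‖(fun _ : Config N => (1 : ℝ)) Y‖ₑ ^ (2 : ℝ) ≠ ⊤ := by
    simp only [enorm_one, ENNReal.one_rpow, setLIntegral_const, one_mul]
    exact (volume_boxN_lt_top N L).ne
  have hsymm := setIntegral_mul_fkReal_comm hv L ht2 hg measurable_const hg2 h1mass
  -- `hsymm : ∫_Λ 1 * h = ∫_Λ g * e^{-tH/2} 1`
  have hRpos : 0 < ∫ Y in boxN N L, g Y * fkReal v L (t / 2) (fun _ => (1 : ℝ)) Y := by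
    have hF0 : ∀ Y, 0 ≤ g Y * fkReal v L (t / 2) (fun _ => (1 : ℝ)) Y := fun Y =>
      mul_nonneg (hg0 Y) (fkReal_nonneg v L _ (fun _ => zero_le_one) Y)
    have hIO : IntegrableOn (fun Y => g Y * fkReal v L (t / 2) (fun _ => (1 : ℝ)) Y) (boxN N L) volume :=
      integrable_mul_fkReal hv L ht2.le measurable_const hg h1mass hg2
    rw [setIntegral_pos_iff_support_of_nonneg_ae (μ := volume) (Eventually.of_forall hF0) hIO]
    -- the support contains `{g ≠ 0} ∩ Λ`, of positive measure
    have hsub : {Y | g Y ≠ 0} ∩ boxN N L ⊆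
        Function.support (fun Y => g Y * fkReal v L (t / 2) (fun _ => (1 : ℝ)) Y) ∩ boxN N L := by
      rintro Y ⟨hY1, hY2⟩
      exact ⟨mul_ne_zero hY1 (fkReal_one_pos hv hC ht2 hY2).ne', hY2⟩
    refine lt_of_lt_of_le (pos_iff_ne_zero.2 fun h0 => hne ?_) (measure_mono hsub)
    rw [Filter.EventuallyEq, ae_iff, Measure.restrict_apply' (measurableSet_boxN N L)]
    simpa using h0
  have hint_h : 0 < ∫ Y in boxN N L, h Y := by
    have h1 : ∫ Y in boxN N L, (fun _ : Config N => (1 : ℝ)) Y * fkReal v L (t / 2) g Y =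
        ∫ Y in boxN N L, h Y := by simp [hh]
    rw [← h1, hsymm]
    exact hRpos
  -- a point of the box where `h > 0`
  obtain ⟨Y, hYD, hY⟩ : ∃ Y ∈ boxN N L, 0 < h Y := by
    by_contra hcon
    push Not at hcon
    have hzero : ∫ Y in boxN N L, h Y = 0 :=
      setIntegral_eq_zero_of_forall_eq_zero fun Y hY => le_antisymm (hcon Y hY) (hh0 Y)
    linarith
  -- continuity of `h` at `Y`: `h ≥ h(Y)/2` on a coordinate box around `Y`
  have hcont := continuousAt_fkReal hv hC L ht2 hg hg2 hYD
  obtain ⟨δ, hδ, hδh⟩ := Metric.continuousAt_iff.1 hcont (h Y / 2) (half_pos hY)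
  obtain ⟨ε₀, hε₀, hmargin₀⟩ := exists_margin_segment hX hYD
  set ε : ℝ := min ε₀ (δ / 3) with hεdef
  have hε : 0 < ε := lt_min hε₀ (by positivity)
  have hmargin : ∀ (W : Config N) (θ : ℝ), θ ∈ Set.Icc (0 : ℝ) 1 →
      (∀ i k, |W i k - ((1 - θ) * X i k + θ * Y i k)| ≤ ε) → W ∈ boxN N L :=
    fun W θ hθ hW => hmargin₀ W θ hθ fun i k => (hW i k).trans (min_le_left _ _)
  have h3 : Real.sqrt 3 < 3 := by
    rw [show (3 : ℝ) = Real.sqrt (3 ^ 2) by rw [Real.sqrt_sq (by norm_num)]]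
    exact Real.sqrt_lt_sqrt (by norm_num) (by norm_num)
  have hha : ∀ Z : Config N, (∀ i k, |Z i k - Y i k| ≤ ε) → h Y / 2 ≤ h Z := by
    intro Z hZ
    have hd : dist Z Y < δ := by
      calc dist Z Y ≤ Real.sqrt 3 * ε := dist_le_of_abs_coord_le hε.le hZ
        _ ≤ Real.sqrt 3 * (δ / 3) := mul_le_mul_of_nonneg_left (min_le_right _ _) (Real.sqrt_nonneg _)
        _ < 3 * (δ / 3) := mul_lt_mul_of_pos_right h3 (by positivity)
        _ = δ := by ring
    have hdist := hδh hd
    rw [Real.dist_eq, abs_sub_lt_iff] at hdist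
    linarith [hdist.1, hdist.2]
  -- semigroup law and the tube lower bound
  have ht2' : (t / 2).toNNReal ≠ 0 := by simpa using ht2
  have hsemi : fkReal v L t g X = fkReal v L (t / 2) h X := by
    have := fkReal_add_time hv L ht2 ht2 hg hg2 X
    rwa [add_halves] at this
  have hlow := fkReal_ge_of_tube hv hC ht2' hmargin hhm hh0 hhK (half_pos hY).le hha
  have hpos := measure_ratTube_pos (N := N) (t / 2).toNNReal ht2'
    (fun i k => (Y i k - X i k) / Real.sqrt 2) (ε := ε / Real.sqrt 2) (by positivity)
  rw [Real.coe_toNNReal _ ht2.le] at hlow hpos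
  rw [hsemi]
  refine lt_of_lt_of_le ?_ hlow
  exact mul_pos (mul_pos (Real.exp_pos _) (half_pos hY))
    (ENNReal.toReal_pos hpos.ne' (measure_ne_top _ _))

end Literature.MathematicalPhysics.QuantumManyBody.BoseGas

end
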